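import Mathlib
import HarnessLib.Audit
import Summits.PneNP.PneNP.Theorems.PstarChordBridgeForest
import Summits.PneNP.PneNP.Theorems.PstarGateTerminal

/-!
# Forest-edge minimality with ONE gated chord: the defect form survives the gate (ROUND-25, O2 / E2; prover-1 g18)

FRONTIER range-avoidance ladder, rung F-N3 (`stmt-PneNP-19007`), cell `pnp-ideate` (this seat's `HOME/pnp-ideate-prover-1/g18/E2-PLAN.md` §3 (P2)/(P3), §5);
restricted-model proof complexity — nothing here bears on `P` versus `NP`.

`PstarChordBridgeForest.forest_minimality` turns (M0) at a forest edge `j ∈ D e₁` into the DEFECT form (`δ = u_{e₁} + m_{e₁} = 1`: the chords through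
`j` get the flipped prescription, the constraints whose join runs through `j` get the flipped target) — but only when no pendant touches the privates of
the demoted chord `e₁`.  In the E2 configuration the gated chord `e` is exactly the chord whose fundamental path carries the interesting forest edges,
and its private `p = vars e 2` IS touched, by the gate `g₀ = (p, u)`.  This file shows the defect form is unchanged:

* `free_erase_add` — splitting one monomial off the state-free part;
* `free_exchange_gate` — the first constraint's state-free part after the exchange `j ↔ e`: the clean corrections of `free_exchange` PLUS the gate
  monomial `x_p x_u` (which is a clean pendant once `e` is a forest edge);
* `gate_forest_minimality` — **(M0) at a forest edge `j ∈ D e`, defect form, for the one-gate bridge data**: with `x = bit ∘ z`, `δ = u_e(x) + x_p x_{p'}`,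
  every other chord has `p' q' = u_{e'}(x) + [j ∈ D e']·δ` and `val N x s = t + (δ[j ∈ T₁], δ[j ∈ T₂])` — verbatim the clean statement (the extra
  `x_p x_u` of the exchanged free part is the gate's read `x_p · ℓ` minus its linear piece); `PstarChordBridgeForest.defect_eq_one` gives `δ = 1` as is.
-/

set_option linter.dupNamespace false -- `Summit.PneNP.PneNP.…`: summit = sub-problem name (D-0017 single-conjunct layout)

open Finset Literature.Computability.Complexity
open scoped symmDiff
open Summit.PneNP.PneNP.Theorems.PstarFibrePolys (bit bit_xor bit_and bit_injective)
open Summit.PneNP.PneNP.Theorems.PstarTyped (Typed)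
open Summit.PneNP.PneNP.Theorems.PstarSALevel (varSet bdry)
open Summit.PneNP.PneNP.Theorems.PstarGapOneAll (gval)
open Summit.PneNP.PneNP.Theorems.PstarXCore (xpair xverts mem_xpair)
open Summit.PneNP.PneNP.Theorems.PstarChordRepair (IsChord)
open Summit.PneNP.PneNP.Theorems.PstarReadSumset (V2)
open Summit.PneNP.PneNP.Theorems.PstarChordSystem (ChordSystem)
open Summit.PneNP.PneNP.Theorems.PstarChordBridgeTools
open Summit.PneNP.PneNP.Theorems.PstarChordBridge
open Summit.PneNP.PneNP.Theorems.PstarChordBridgeForcing (coef_of_unread)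
open Summit.PneNP.PneNP.Theorems.PstarChordBridgeExchange
open Summit.PneNP.PneNP.Theorems.PstarChordBridgeForest (privs_erase free_exchange)
open Summit.PneNP.PneNP.Theorems.PstarGateTerminal (coef_single_gate)

namespace Summit.PneNP.PneNP.Theorems.PstarGateForest

variable {n m : ℕ}

/-- **Splitting one monomial off the state-free part.** -/
theorem free_erase_add (I : LocalMap 4 n m) (y : Fin m → Bool) (F N T : Finset (Fin m)) (C : Finset (Fin n)) {G : Finset (Fin m)} {g₀ : Fin m}
    (hg₀ : g₀ ∈ G) (x : Fin n → ZMod 2) :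
    free I y F N T C G x = free I y F N T C (G.erase g₀) x +
      (if ¬ (I.vars g₀ 2 ∈ privs I N ∨ I.vars g₀ 3 ∈ privs I N) then x (I.vars g₀ 2) * x (I.vars g₀ 3) else 0) := by
  classical
  unfold free
  have hG : G = insert g₀ (G.erase g₀) := (insert_erase hg₀).symm
  conv_lhs => rw [hG]
  rw [filter_insert]
  by_cases h : I.vars g₀ 2 ∈ privs I N ∨ I.vars g₀ 3 ∈ privs I N
  · rw [if_neg (not_not.2 h), if_neg (not_not.2 h), add_zero]
  · rw [if_pos h, if_pos h, sum_insert (fun h' => (mem_erase.1 (mem_filter.1 h').1).1 rfl)]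
    ring

/-- **The first constraint's state-free part after the exchange, with the gate.**  `g₀ ∈ G` is the only monomial touching the privates of `e₁`, its
AND pair being `(vars e₁ 2, u)` (either order) with `u` no private; then the exchanged free part is the clean one of `free_exchange` plus `x_p x_u`. -/
theorem free_exchange_gate (I : LocalMap 4 n m) (hI : I.IsPure xorAndPred) (hT : Typed I) {B : BridgeData n m} (hW : B.WF I) {j e₁ : Fin m}
    (he₁ : e₁ ∈ B.N) (hj : j ∈ B.D e₁) {T : Finset (Fin m)} (C : Finset (Fin n)) {G : Finset (Fin m)} {g₀ : Fin m} (hg₀ : g₀ ∈ G) {u : Fin n}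
    (hgv : (I.vars g₀ 2 = I.vars e₁ 2 ∧ I.vars g₀ 3 = u) ∨ (I.vars g₀ 2 = u ∧ I.vars g₀ 3 = I.vars e₁ 2)) (hu : u ∉ privs I B.N)
    (hG : ∀ g ∈ G.erase g₀, I.vars g 2 ≠ I.vars e₁ 2 ∧ I.vars g 2 ≠ I.vars e₁ 3 ∧ I.vars g 3 ≠ I.vars e₁ 2 ∧ I.vars g 3 ≠ I.vars e₁ 3)
    (x : Fin n → ZMod 2) :
    free I B.y ((exchange B j e₁).J₀ \ (exchange B j e₁).N) (B.N.erase e₁) (if j ∈ T then T ∆ insert e₁ (B.D e₁) else T) C G x =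
      free I B.y (B.J₀ \ B.N) B.N T C G x + (if j ∈ T then (sys I B).u e₁ x + x (I.vars e₁ 2) * x (I.vars e₁ 3) else 0)
        + (if I.vars e₁ 2 ∈ C then x (I.vars e₁ 2) else 0) + (if I.vars e₁ 3 ∈ C then x (I.vars e₁ 3) else 0)
        + x (I.vars e₁ 2) * x u := by
  classical
  have hp : I.vars e₁ 2 ∈ privs I B.N := vars_mem_privs I he₁ (s := 2) (by decide)
  -- w.r.t. `N` the gate touches a private: it is not in the clean free part
  have htouch : I.vars g₀ 2 ∈ privs I B.N ∨ I.vars g₀ 3 ∈ privs I B.N := by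
    rcases hgv with ⟨h2, -⟩ | ⟨-, h3⟩
    · exact Or.inl (h2 ▸ hp)
    · exact Or.inr (h3 ▸ hp)
  -- w.r.t. `N − e₁` it touches none
  have hup : u ∉ privs I (B.N.erase e₁) := fun h => hu ((privs_erase I hW.hN hW.hchord he₁ u).1 h).1
  have hpp : I.vars e₁ 2 ∉ privs I (B.N.erase e₁) := fun h => ((privs_erase I hW.hN hW.hchord he₁ _).1 h).2.1 rfl
  have havoid : ¬ (I.vars g₀ 2 ∈ privs I (B.N.erase e₁) ∨ I.vars g₀ 3 ∈ privs I (B.N.erase e₁)) := by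
    rcases hgv with ⟨h2, h3⟩ | ⟨h2, h3⟩
    · rw [h2, h3]; exact fun h => h.elim hpp hup
    · rw [h2, h3]; exact fun h => h.elim hup hpp
  have hmono : x (I.vars g₀ 2) * x (I.vars g₀ 3) = x (I.vars e₁ 2) * x u := by
    rcases hgv with ⟨h2, h3⟩ | ⟨h2, h3⟩
    · rw [h2, h3]
    · rw [h2, h3, mul_comm]
  rw [free_erase_add I B.y _ _ _ C hg₀, if_pos havoid, free_exchange I hI hT hW he₁ hj C hG x, free_erase_add I B.y _ _ _ C hg₀ x,
    if_neg (not_not.2 htouch), hmono]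
  ring

/-- **(M0) at a forest edge of the gated chord's path, defect form.**  One-gate bridge data: `e ∈ N` the gated chord (gate `g₀ ∈ G₁` on `p = vars e 2`
with partner `u` not private, no other monomial touching `p, p' = vars e 3`, the second constraint's monomials avoiding both), `j ∈ D e` a forest edge, `z`
a solution of `(J₀ − j) ∧ Γ₁ ∧ Γ₂`.  Then with `x = bit ∘ z`, `δ := u_e(x) + x_p x_{p'}`: every other chord has `p_{e'} q_{e'} = u_{e'}(x) + [j ∈ D e']·δ`
and `val N x s = t + (δ[j ∈ T₁], δ[j ∈ T₂])` — exactly as in `PstarChordBridgeForest.forest_minimality`. -/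
theorem gate_forest_minimality (I : LocalMap 4 n m) (hI : I.IsPure xorAndPred) (hT : Typed I) {B : BridgeData n m} (hW : B.WF I) {j e : Fin m}
    (he : e ∈ B.N) (hj : j ∈ B.D e) {g₀ : Fin m} (hg₀ : g₀ ∈ B.G₁) {u : Fin n}
    (hgv : (I.vars g₀ 2 = I.vars e 2 ∧ I.vars g₀ 3 = u) ∨ (I.vars g₀ 2 = u ∧ I.vars g₀ 3 = I.vars e 2)) (hu : u ∉ privs I B.N)
    (hG₁ : ∀ g ∈ B.G₁.erase g₀, I.vars g 2 ≠ I.vars e 2 ∧ I.vars g 2 ≠ I.vars e 3 ∧ I.vars g 3 ≠ I.vars e 2 ∧ I.vars g 3 ≠ I.vars e 3)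
    (hG₂ : ∀ g ∈ B.G₂, I.vars g 2 ≠ I.vars e 2 ∧ I.vars g 2 ≠ I.vars e 3 ∧ I.vars g 3 ≠ I.vars e 2 ∧ I.vars g 3 ≠ I.vars e 3)
    {z : Fin n → Bool} (hz : Solution I B (B.J₀.erase j) z) :
    (∀ e' ∈ B.N, e' ≠ e → bit (z (I.vars e' 2)) * bit (z (I.vars e' 3)) =
        (sys I B).u e' (fun v => bit (z v)) +
          (if j ∈ B.D e' then (sys I B).u e (fun v => bit (z v)) + bit (z (I.vars e 2)) * bit (z (I.vars e 3)) else 0)) ∧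
    (sys I B).val B.N (fun v => bit (z v)) (fun e' => (bit (z (I.vars e' 2)), bit (z (I.vars e' 3)))) =
      (sys I B).t +
        ((if j ∈ B.T₁ then (sys I B).u e (fun v => bit (z v)) + bit (z (I.vars e 2)) * bit (z (I.vars e 3)) else 0),
         (if j ∈ B.T₂ then (sys I B).u e (fun v => bit (z v)) + bit (z (I.vars e 2)) * bit (z (I.vars e 3)) else 0)) := by
  classical
  set B' := exchange B j e with hB'
  have hW' : B'.WF I := exchange_wf I hI hW he hj
  have hjN : j ∉ B.N := (mem_sdiff.1 (hW.hD e he hj)).2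
  have hzF : ∀ k ∈ B'.J₀ \ B'.N, I.eval z k = B'.y k := fun k hk => hz.1 k (mem_sdiff.1 hk).1
  -- the gate's AND pair avoids `p'`, and `u ≠ p'`
  have hpp' : I.vars e 2 ≠ I.vars e 3 := fun h => absurd (hI.2 e h) (by decide)
  have hup' : u ≠ I.vars e 3 := fun h => hu (h ▸ vars_mem_privs I he (s := 3) (by decide))
  have hG₁p' : ∀ g ∈ B.G₁, I.vars g 2 ≠ I.vars e 3 ∧ I.vars g 3 ≠ I.vars e 3 := by
    intro g hg
    by_cases hgg : g = g₀
    · subst hgg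
      rcases hgv with ⟨h2, h3⟩ | ⟨h2, h3⟩
      · rw [h2, h3]; exact ⟨hpp', hup'⟩
      · rw [h2, h3]; exact ⟨hup', hpp'⟩
    · exact ⟨(hG₁ g (mem_erase.2 ⟨hgg, hg⟩)).2.1, (hG₁ g (mem_erase.2 ⟨hgg, hg⟩)).2.2.2⟩
  refine ⟨fun e' he' hne => ?_, ?_⟩
  · have heN' : e' ∈ B'.N := mem_erase.2 ⟨hne, he'⟩
    have heJ : e' ∈ B.J₀.erase j := mem_erase.2 ⟨fun h => hjN (h ▸ he'), hW.hN he'⟩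
    have hadm := (eval_iff_adm I hI hW' hzF heN').1 (hz.1 e' heJ)
    rw [hadm, hB', sys_exchange_u I hW he]
  · set x : Fin n → ZMod 2 := fun v => bit (z v) with hx
    have hF₁ := free_exchange_gate I hI hT hW he hj (T := B.T₁) B.C₁ hg₀ hgv hu hG₁ x
    have hF₂ := free_exchange I hI hT hW he hj (T := B.T₂) B.C₂ hG₂ x
    have h := val_of_solution I hI hT hW' hzF
    rw [val_sys] at h
    have h' : ((free I B.y ((exchange B j e).J₀ \ (exchange B j e).N) (B.N.erase e) (if j ∈ B.T₁ then B.T₁ ∆ insert e (B.D e) else B.T₁) B.C₁ B.G₁ x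
          + ∑ e' ∈ B.N.erase e, ((bit (z (I.vars e' 2)), bit (z (I.vars e' 3))).1 * coef I B.C₁ B.G₁ (I.vars e' 2) x
              + (bit (z (I.vars e' 2)), bit (z (I.vars e' 3))).2 * coef I B.C₁ B.G₁ (I.vars e' 3) x),
        free I B.y ((exchange B j e).J₀ \ (exchange B j e).N) (B.N.erase e) (if j ∈ B.T₂ then B.T₂ ∆ insert e (B.D e) else B.T₂) B.C₂ B.G₂ x
          + ∑ e' ∈ B.N.erase e, ((bit (z (I.vars e' 2)), bit (z (I.vars e' 3))).1 * coef I B.C₂ B.G₂ (I.vars e' 2) x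
              + (bit (z (I.vars e' 2)), bit (z (I.vars e' 3))).2 * coef I B.C₂ B.G₂ (I.vars e' 3) x)) : V2) =
        (bit (gval I B.C₁ B.G₁ z), bit (gval I B.C₂ B.G₂ z)) := h
    rw [hz.2.1, hz.2.2, hF₁, hF₂] at h'
    have h1 := congrArg Prod.fst h'
    have h2 := congrArg Prod.snd h'
    simp only at h1 h2
    -- the read coefficients of the privates of `e`: the gate on `p`, nothing on `p'`, nothing in constraint 2
    have hc1p : coef I B.C₁ B.G₁ (I.vars e 2) x = (if I.vars e 2 ∈ B.C₁ then 1 else 0) + x u :=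
      coef_single_gate I hI hg₀ hgv (fun g hg => ⟨(hG₁ g hg).1, (hG₁ g hg).2.2.1⟩) x
    have hc1p' : coef I B.C₁ B.G₁ (I.vars e 3) x = (if I.vars e 3 ∈ B.C₁ then 1 else 0) := coef_of_unread I hG₁p' _
    have hc2p : coef I B.C₂ B.G₂ (I.vars e 2) x = (if I.vars e 2 ∈ B.C₂ then 1 else 0) :=
      coef_of_unread I (fun g hg => ⟨(hG₂ g hg).1, (hG₂ g hg).2.2.1⟩) _
    have hc2p' : coef I B.C₂ B.G₂ (I.vars e 3) x = (if I.vars e 3 ∈ B.C₂ then 1 else 0) :=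
      coef_of_unread I (fun g hg => ⟨(hG₂ g hg).2.1, (hG₂ g hg).2.2.2⟩) _
    have hsum : ∀ (C : Finset (Fin n)) (G : Finset (Fin m)),
        ∑ e' ∈ B.N, ((bit (z (I.vars e' 2)), bit (z (I.vars e' 3))).1 * coef I C G (I.vars e' 2) x
            + (bit (z (I.vars e' 2)), bit (z (I.vars e' 3))).2 * coef I C G (I.vars e' 3) x) =
        ((bit (z (I.vars e 2)), bit (z (I.vars e 3))).1 * coef I C G (I.vars e 2) x
            + (bit (z (I.vars e 2)), bit (z (I.vars e 3))).2 * coef I C G (I.vars e 3) x) +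
        ∑ e' ∈ B.N.erase e, ((bit (z (I.vars e' 2)), bit (z (I.vars e' 3))).1 * coef I C G (I.vars e' 2) x
            + (bit (z (I.vars e' 2)), bit (z (I.vars e' 3))).2 * coef I C G (I.vars e' 3) x) :=
      fun C G => (add_sum_erase B.N _ he).symm
    rw [val_sys, sys_t, hsum B.C₁ B.G₁, hsum B.C₂ B.G₂, hc1p, hc1p', hc2p, hc2p']
    have hxp : x (I.vars e 2) = bit (z (I.vars e 2)) := rfl
    have hxq : x (I.vars e 3) = bit (z (I.vars e 3)) := rfl
    have hxu : x u = bit (z u) := rfl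
    rw [hxp, hxq, hxu] at h1
    rw [hxp, hxq] at h2
    rw [hxu]
    refine Prod.ext ?_ ?_
    · simp only [Prod.fst_add, mul_add, mul_ite, mul_one, mul_zero] at h1 ⊢
      have hj2 : (if j ∈ B.T₁ then (sys I B).u e x + bit (z (I.vars e 2)) * bit (z (I.vars e 3)) else 0)
          + (if j ∈ B.T₁ then (sys I B).u e x + bit (z (I.vars e 2)) * bit (z (I.vars e 3)) else 0) = 0 := by
        generalize (if j ∈ B.T₁ then (sys I B).u e x + bit (z (I.vars e 2)) * bit (z (I.vars e 3)) else 0) = t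
        revert t; decide
      linear_combination h1 - hj2
    · simp only [Prod.snd_add, mul_ite, mul_one, mul_zero] at h2 ⊢
      have hj2 : (if j ∈ B.T₂ then (sys I B).u e x + bit (z (I.vars e 2)) * bit (z (I.vars e 3)) else 0)
          + (if j ∈ B.T₂ then (sys I B).u e x + bit (z (I.vars e 2)) * bit (z (I.vars e 3)) else 0) = 0 := by
        generalize (if j ∈ B.T₂ then (sys I B).u e x + bit (z (I.vars e 2)) * bit (z (I.vars e 3)) else 0) = t
        revert t; decide
      linear_combination h2 - hj2

end Summit.PneNP.PneNP.Theorems.PstarGateForest
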